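import Summits.BirchSwinnertonDyer.BirchSwinnertonDyer.Theorems.CumulativeHeegnerLeopoldtCumulativeHeegnerInclusionAtThreeUnrSeriesTadicPin
import Summits.BirchSwinnertonDyer.Rank1Residual.X11b.AnticyclotomicSelmerDual
import Summits.BirchSwinnertonDyer.Rank1Residual.X11b.BDPRouteOpenInputDegenerateFrame
import HarnessLib

/-!
# Crux K1 `CumulativeHeegnerInclusionAtThree` (stmt-BirchSwinnertonDyer-24198), line `birth` — STUB A
# (`TemperedHeegnerInclusionAtThree`, crux 26896): the `T`-adic pin is DISCHARGED by the shape of the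
# control crux K4 — `XAc.HasCharValuationAt` ⟹ the generator of `(Ch_Λ X).map toUnr` does not vanish
# at `T = 0` ⟹ a `Λ^ur[1/3, 1/T]`-divisibility (or a weighted domination on the disc) already gives
# stub A's conclusion VERBATIM

Width seat bsd-line-chl-k1-p1-w2 (`--supports stmt-BirchSwinnertonDyer-24198`), Λ^ur-adapter lane (ceded by
the K1 lead, STATUS 09:41Z). Stub A concludes
`∃ μ, Ideal.span {(3 : UnrSeries 3) ^ μ * L} ≤ (XAc.charIdeal (W.baseChange K) 3 κ 𝔭' ∅ γ).map (PowerSeries.map (toUnr 3))`.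
The companion file `…UnrSeriesTadicPin` removes a power of `T` from a divisibility under the pin
`ord_T g ≤ ord_T L`, automatic when `g(0) ≠ 0`. HERE the pin is read off the route's own control
currency: crux K4 `RedSplitControlAtThree` / `SchneiderFree.AdditiveControlOnTreeAt` conclude
`∃ n, XAc.HasCharValuationAt (W.baseChange K) p κ 𝔭 ∅ γ n ∧ …`, and `HasCharValuationAt` says: `X` is
`Λ`-torsion and `Ch_Λ X = (f)` with `f(0) ≠ 0` (`ord_p f(0) = n`). Hence (§2) the image ideal in
`Λ^ur = R₀⟦T⟧` is `(g)` with `g = f.map toUnr`, `g(0) = toUnr f(0) ≠ 0` (§1; `toUnr : ℤ_p → R₀` is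
injective, tree `X11b.toUnr_injective`), and (§3) for every `L ∈ R₀⟦T⟧`:

* `span_pow_mul_le_map_charIdeal_of_X_pow` — `(∃ μ ν, span{p^μ T^ν · L} ≤ (Ch_Λ X).map toUnr) ⟹
  ∃ μ, span{p^μ · L} ≤ (Ch_Λ X).map toUnr` (the `Λ[1/p, 1/T]` bound of a residually REDUCIBLE
  Kolyvagin-system argument suffices, GIVEN the control shape at the trivial character);
* `span_pow_mul_le_map_charIdeal_of_weighted_norm_value_le` — the same from a WEIGHTED DOMINATION
  `‖x‖^ν ‖L(x)‖ ≤ C ‖g(x)‖` off a finite set of the open unit disc of `ℂ_p`, for any generator `g` of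
  the image ideal (`…UnrSeriesTadicPin.exists_C_pow_mul_mem_span_of_weighted_norm_value_le`).

So on the Leopoldt cell the twist-rank / corank-1 issue of evidence #28 §4b is NOT an extra hypothesis
of A once K4 (already a crux of the route, binder of the kernel) is granted in its `HasCharValuationAt`
shape: K4 ⟹ pin. (The content of A remains the bound itself.)

HONEST FRAMING: bookkeeping between `Λ` and `Λ^ur` plus the two companions; nothing about the Selmer
module is proved here beyond reading the `HasCharValuationAt` shape; closes nothing by itself. No
definition, no named fact, no `sorry`. BSD is not proved by any of this; no summit statement is proved
by this seat.

References: [Castella2018] Thm. 2.3 (the shape `#ℤ_p/f_ac(0)`); [JetchevSkinnerWan2017] Thm. 3.3.1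
(anticyclotomic control); [MazurRubin2004] Thm. 5.3.10; evidence #28 §4b on stmt-BirchSwinnertonDyer-24198.
-/

set_option autoImplicit false
-- `…BirchSwinnertonDyer.BirchSwinnertonDyer.Theorems…` is the problem's mandated namespace (D-0017).
set_option linter.dupNamespace false

noncomputable section

open scoped Classical

open PowerSeries NumberField IsDedekindDomain Field Literature.NumberTheory.EllipticCurves
  Summit.BirchSwinnertonDyer.Rank1Residual.X11b.Halves
  Summit.BirchSwinnertonDyer.Rank1Residual.X11b.AcSelmer
  Summit.BirchSwinnertonDyer.BirchSwinnertonDyer.Theorems.CumulativeHeegnerInclusionAtThreeUnrSeriesTadicPin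

namespace Summit.BirchSwinnertonDyer.BirchSwinnertonDyer.Theorems.CumulativeHeegnerInclusionAtThreeTadicPinOfControl

universe u

variable {p : ℕ} [hp : Fact p.Prime]

/-! ### §1 `Λ = ℤ_p⟦T⟧ → Λ^ur = R₀⟦T⟧`: constant terms (injectivity is the tree's `X11b.toUnr_injective`) -/

/-- Constant term of the base change: `(f.map toUnr)(0) = toUnr (f(0))`. [folklore] -/
theorem constantCoeff_map_toUnr (f : IwasawaAlgebra p) :
    constantCoeff ((PowerSeries.map (toUnr p)) f) = toUnr p (constantCoeff f) := by
  rw [← coeff_zero_eq_constantCoeff_apply, coeff_map, coeff_zero_eq_constantCoeff_apply]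

/-- `f(0) ≠ 0 ⟹ (f.map toUnr)(0) ≠ 0`: the base change to `Λ^ur` does not create a zero at the trivial
character. [folklore] -/
theorem constantCoeff_map_toUnr_ne_zero {f : IwasawaAlgebra p} (hf : constantCoeff f ≠ 0) :
    constantCoeff ((PowerSeries.map (toUnr p)) f) ≠ 0 := by
  rw [constantCoeff_map_toUnr]
  intro h
  exact hf (Summit.BirchSwinnertonDyer.Rank1Residual.X11b.toUnr_injective (by rw [h, map_zero]))

/-- The image in `Λ^ur` of a principal ideal `(f) ⊆ Λ` is the principal ideal `(f.map toUnr)`.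
[folklore] -/
theorem map_span_singleton_toUnr (f : IwasawaAlgebra p) :
    (Ideal.span {f}).map (PowerSeries.map (toUnr p)) = Ideal.span {(PowerSeries.map (toUnr p)) f} := by
  rw [Ideal.map_span, Set.image_singleton]

/-! ### §2 The control shape `HasCharValuationAt` supplies a generator non-vanishing at `T = 0` -/

section Control

variable {K : Type u} [Field K] [NumberField K] {W : WeierstrassCurve K} {κ : ZpExtension K p}
  {𝔭 : HeightOneSpectrum (𝓞 K)} {S : Set (HeightOneSpectrum (𝓞 K))} {γ : absoluteGaloisGroup K}
  [Fact (κ.IsTopGenerator γ)]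

/-- **K4's shape ⟹ the pin's input.** If `XAc.HasCharValuationAt W p κ 𝔭 S γ n` (the conclusion shape
of the control crux: `X_ac` is `Λ`-torsion with `Ch_Λ X = (f)`, `f(0) ≠ 0`, `ord_p f(0) = n`), then the
image ideal `(Ch_Λ X).map toUnr ⊆ R₀⟦T⟧` is principal with a generator `g` satisfying `g(0) ≠ 0`.
[cite: Castella2018, Thm. 2.3] -/
theorem exists_generator_map_charIdeal_of_hasCharValuationAt {n : ℕ}
    (h : XAc.HasCharValuationAt W p κ 𝔭 S γ n) :
    ∃ g : UnrSeries p, (XAc.charIdeal W p κ 𝔭 S γ).map (PowerSeries.map (toUnr p)) = Ideal.span {g} ∧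
      constantCoeff g ≠ 0 := by
  obtain ⟨-, f, hf, hf0, -⟩ := h
  exact ⟨(PowerSeries.map (toUnr p)) f, by rw [hf, map_span_singleton_toUnr],
    constantCoeff_map_toUnr_ne_zero hf0⟩

/-- Every generator of the image ideal is then non-vanishing at `T = 0` (two generators differ by a
unit of the domain `R₀⟦T⟧`, whose constant term is a unit). [cite: Castella2018, Thm. 2.3] -/
theorem constantCoeff_ne_zero_of_hasCharValuationAt {n : ℕ} (h : XAc.HasCharValuationAt W p κ 𝔭 S γ n)
    {g : UnrSeries p} (hg : (XAc.charIdeal W p κ 𝔭 S γ).map (PowerSeries.map (toUnr p)) = Ideal.span {g}) :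
    constantCoeff g ≠ 0 := by
  obtain ⟨g₀, hg₀, hg₀0⟩ := exists_generator_map_charIdeal_of_hasCharValuationAt h
  rw [hg₀] at hg
  obtain ⟨u, rfl⟩ := Ideal.span_singleton_eq_span_singleton.mp hg
  rw [map_mul]
  exact mul_ne_zero hg₀0 (PowerSeries.isUnit_constantCoeff _ u.isUnit).ne_zero

/-! ### §3 Stub A's conclusion from a `Λ^ur[1/p, 1/T]`-bound or a weighted domination, granted K4's shape -/

/-- **`Λ^ur[1/p, 1/T]` suffices, granted the control shape.** If `XAc.HasCharValuationAt W p κ 𝔭 S γ n`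
and `span{p^μ T^ν · L} ≤ (Ch_Λ X_ac).map toUnr` for some `μ, ν`, then
`span{p^{μ'} · L} ≤ (Ch_Λ X_ac).map toUnr` for some `μ'` — VERBATIM the shape of stub A's conclusion
(at `p = 3`, `W.baseChange K`, `𝔭'`, `S = ∅`). The `T`-power that a residually reducible Kolyvagin-system
argument cannot control is absorbed by the control theorem at the trivial character.
[cite: MazurRubin2004, Thm. 5.3.10] [cite: Castella2018, Thm. 2.3] -/
theorem span_pow_mul_le_map_charIdeal_of_X_pow {n : ℕ} (h : XAc.HasCharValuationAt W p κ 𝔭 S γ n)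
    {L : UnrSeries p}
    (hdiv : ∃ μ ν : ℕ, Ideal.span {((p : ℕ) : UnrSeries p) ^ μ * X ^ ν * L} ≤
      (XAc.charIdeal W p κ 𝔭 S γ).map (PowerSeries.map (toUnr p))) :
    ∃ μ : ℕ, Ideal.span {((p : ℕ) : UnrSeries p) ^ μ * L} ≤
      (XAc.charIdeal W p κ 𝔭 S γ).map (PowerSeries.map (toUnr p)) := by
  obtain ⟨g, hg, hg0⟩ := exists_generator_map_charIdeal_of_hasCharValuationAt h
  obtain ⟨μ, ν, hμν⟩ := hdiv
  rw [hg] at hμν ⊢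
  refine ⟨μ, ?_⟩
  rw [Ideal.span_singleton_le_iff_mem] at hμν ⊢
  exact mul_mem_span_of_X_pow_mul_mem_span_of_constantCoeff_ne_zero hμν hg0

/-- **Weighted domination suffices, granted the control shape.** If `XAc.HasCharValuationAt W p κ 𝔭 S γ n`
and, for a generator `g` of `(Ch_Λ X_ac).map toUnr`, `‖x‖^ν · ‖L(x)‖ ≤ C · ‖g(x)‖` at every point of the
open unit disc of `ℂ_p` outside a finite set `F`, then `span{p^μ · L} ≤ (Ch_Λ X_ac).map toUnr` for some
`μ` — stub A's conclusion shape. [cite: Washington1997, §7.1 Thm. 7.3] [cite: MazurRubin2004, Thm. 5.3.10] -/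
theorem span_pow_mul_le_map_charIdeal_of_weighted_norm_value_le {n : ℕ}
    (h : XAc.HasCharValuationAt W p κ 𝔭 S γ n) {g L : UnrSeries p}
    (hg : (XAc.charIdeal W p κ 𝔭 S γ).map (PowerSeries.map (toUnr p)) = Ideal.span {g})
    {F : Set ℂ_[p]} (hF : F.Finite) {ν : ℕ} {C : ℝ}
    (hdom : ∀ x : ℂ_[p], x ∉ F → ‖x‖ < 1 → ∀ u v : ℂ_[p], g.HasValueAt x u → L.HasValueAt x v →
      ‖x‖ ^ ν * ‖v‖ ≤ C * ‖u‖) :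
    ∃ μ : ℕ, Ideal.span {((p : ℕ) : UnrSeries p) ^ μ * L} ≤
      (XAc.charIdeal W p κ 𝔭 S γ).map (PowerSeries.map (toUnr p)) := by
  have hg0 : constantCoeff g ≠ 0 := constantCoeff_ne_zero_of_hasCharValuationAt h hg
  obtain ⟨μ, hμ⟩ :=
    exists_C_pow_mul_mem_span_of_weighted_norm_value_le_of_constantCoeff_ne_zero hg0 hF hdom
  refine ⟨μ, ?_⟩
  rw [hg, Ideal.span_singleton_le_iff_mem]
  have heq : ((p : ℕ) : UnrSeries p) ^ μ * L = PowerSeries.C (((p : ℕ) : unrIntegers p) ^ μ) * L := by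
    rw [map_pow, map_natCast]
  rwa [heq]

end Control

end Summit.BirchSwinnertonDyer.BirchSwinnertonDyer.Theorems.CumulativeHeegnerInclusionAtThreeTadicPinOfControl

end
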